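import Summits.QuantumFields.YangMills.Theorems.UnitScaleTiltProp7OneFormAgmonLetters
import HarnessLib

/-!
# Route `UnitScaleTilt`, crux K1 «MinimiserStabilityRegPr» (stmt-QuantumFields-19200), EX rows `hCk` ∕ `h137kΔ` (J-slot) — **K-STOREY GLUE (K2b-δ₃)-G (px12 g17): THE FORM OF `Δ_a` AT A SLOT
# `Δx = Δ^η + S` IS THE FORM AT THE SLOT OF RECORD PLUS `⟪·, S·⟫`** — so the two form letters (γ) `hco` and (C_V) `hVlow` AT THE SLOT `Δx` (the inputs of (K2b-δ₃)-E ✓p769760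
# `conj_resolvent_oneForm_phaseClass_slot` and of px10 g13's (K2-KNIT) ✓p768818 at the J-slot `DeltaEtaSlot + TJSlotP`) follow from the η-slot letters of record (✓p767766 `hco_DeltaEtaSlot_exists`,
# px21 ✓p768234 `hVlow_abs_of_lift`) and ONE form row of the slot operator, `−τ‖v‖² ≤ re⟪v, S U₀ v⟫` (for `S = T_Jᴾ`: the τ-row ✓`tauRow_TJP_of_supRow` ⟸ `hTJsup` ⟸ `hHcol` ∧ `hC157`).

Cell `ym3-torus` (HUMAN RULING D-0037: SU(2) YM₃ on T³ is ladder rung R3 — NOT d = 4, NOT infinite volume, NOT a mass gap, NOT Clay).  Width seat `ym3-torus-px12` gen 17.  THEOREMS ONLY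
(0 `def`, 0 `sorry`, default heartbeats); `--supports stmt-QuantumFields-19200 --as helper`, count-neutral.  HONEST LABEL: algebra over A2a ✓`inner_laplaceA_eq₂`; every analytic input displayed;
nothing of `hCk`, `h137kΔ`, EX or 19200 is proved here.

WHAT IS PROVED (ns `Summit.QuantumFields.YangMills.Theorems.Prop7OneFormSlotFormGlue`; member `F`, `h : n ≤ K`, weights `c₀ cB`, coupling `a`, slot `Δx` with `hΔx : Δx U₀ v = Δ^η v + S U₀ v`).
* ★ `inner_laplaceA_slot_eq_add` — `⟪toL2 X′, Δ_a^{Δx}(toL2 X″)⟫ = ⟪toL2 X′, Δ_a^{η}(toL2 X″)⟫ + ⟪toL2 X′, S U₀ (toL2 X″)⟫` (`Δ_a^{η}` := the slot of record `DeltaEtaSlot`).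
* ★★ `hco_slot_of_eta` — `γ‖v‖² ≤ re⟪v, Δ_a^{η}v⟫` and `−τ‖v‖² ≤ re⟪v, S v⟫` ⟹ `(γ − τ)‖v‖² ≤ re⟪v, Δ_a^{Δx}v⟫`.
* ★★ `hVlow_slot_of_eta` — A3's (C_V) letter at `Δ_a^{η}` with `C_V` and the τ-row ⟹ A3's (C_V) letter at `Δ_a^{Δx}` with `C_V + τ`.
HYP-SAT (★★OWNER RULING №42): `hΔx` is `Pi.add_apply`-class for `Δx := DeltaEtaSlot + TJSlotP`; the τ-row is the tree's ✓`tauRow_TJP_of_supRow` output shape (`‖⟪u, Sv⟫‖ ≤ τ‖u‖‖v‖` ⟹ the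
one-sided form row); nothing eventual; no restatement.

References: T. Bałaban, CMP **99** (1985) 389–434 [Balaban1985BackgroundPropagators] ((3.26) p.395, (3.127)–(3.128) p.421); CMP **102** (1985) 277–309 [Balaban1985Variational] ((134)–(136) p.298).
-/

set_option autoImplicit false

noncomputable section

open scoped BigOperators Matrix.Norms.L2Operator InnerProductSpace ComplexConjugate

namespace Summit.QuantumFields.YangMills.Theorems.Prop7OneFormSlotFormGlue

open Literature.MathematicalPhysics.QuantumFieldTheory.Balaban1983to89
open Literature.MathematicalPhysics.QuantumFieldTheory.Balaban1983to89.T3ContinuumYM3Torus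
open T3SectALandauChart (eta eta_pos bgUnits formComp)
open B11Eq103H1Complex (SiteL2K BondL2K)
open Summit.QuantumFields.YangMills.Theorems.Prop7SectET3Transport (periodsT3)
open Summit.QuantumFields.YangMills.Theorems.Prop7SectET3HilbertLetters (W₂ toL2 toL2S DL2)
open Summit.QuantumFields.YangMills.Theorems.Prop7SectET3WilsonHessian (DeltaEta DeltaEtaSlot)
open Summit.QuantumFields.YangMills.Theorems.Prop7SectET3CurvedPropagators (laplaceA)
open Summit.QuantumFields.YangMills.Theorems.Prop7OneFormAgmonLetters (inner_laplaceA_eq₂)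

variable (F : T3Family) {n K : ℕ} (h : n ≤ K) (c₀ cB : ℝ) [Fact (0 < c₀)] [Fact (0 < cB)] {a : ℝ}
  {Δx S : GaugeField (F.P K) 0 (Matrix.specialUnitaryGroup (Fin 2) ℂ) → (BondL2K ℂ 3 (periodsT3 F K) c₀ W₂ →ₗ[ℂ] BondL2K ℂ 3 (periodsT3 F K) c₀ W₂)}

/-- ★ **THE FORM OF `Δ_a` AT THE SLOT `Δx = Δ^η + S` SPLITS**: `⟪toL2 X′, Δ_a^{Δx}(U₀)(toL2 X″)⟫ = ⟪toL2 X′, Δ_a^{η}(U₀)(toL2 X″)⟫ + ⟪toL2 X′, S U₀ (toL2 X″)⟫` — A2a ✓`inner_laplaceA_eq₂` at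
both slots (all pieces but the slot term coincide; the slot term of `DeltaEtaSlot` vanishes). [cite: Balaban1985BackgroundPropagators, (3.26) p.395, (3.128) p.421] -/
theorem inner_laplaceA_slot_eq_add (U₀ : GaugeField (F.P K) 0 (Matrix.specialUnitaryGroup (Fin 2) ℂ))
    (hΔx : ∀ v : BondL2K ℂ 3 (periodsT3 F K) c₀ W₂, Δx U₀ v = DeltaEta F n K c₀ U₀ v + S U₀ v) (X' X'' : PBond (F.P K) 0 → Matrix (Fin 2) (Fin 2) ℂ) :
    ⟪toL2 F K c₀ X', laplaceA F n K h c₀ cB a Δx U₀ (toL2 F K c₀ X'')⟫_ℂ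
      = ⟪toL2 F K c₀ X', laplaceA F n K h c₀ cB a (DeltaEtaSlot F n K c₀) U₀ (toL2 F K c₀ X'')⟫_ℂ + ⟪toL2 F K c₀ X', S U₀ (toL2 F K c₀ X'')⟫_ℂ := by
  have h1 := inner_laplaceA_eq₂ (h := h) (cB := cB) (a := a) (Δx := Δx) U₀ X' X''
  have h2 := inner_laplaceA_eq₂ (h := h) (cB := cB) (a := a) (Δx := DeltaEtaSlot F n K c₀) U₀ X' X''
  have hs1 : (Δx U₀ - (DeltaEta F n K c₀ U₀ : BondL2K ℂ 3 (periodsT3 F K) c₀ W₂ →ₗ[ℂ] BondL2K ℂ 3 (periodsT3 F K) c₀ W₂)) (toL2 F K c₀ X'') = S U₀ (toL2 F K c₀ X'') := by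
    rw [LinearMap.sub_apply, hΔx]; exact add_sub_cancel_left _ _
  have hs2 : (DeltaEtaSlot F n K c₀ U₀ - (DeltaEta F n K c₀ U₀ : BondL2K ℂ 3 (periodsT3 F K) c₀ W₂ →ₗ[ℂ] BondL2K ℂ 3 (periodsT3 F K) c₀ W₂)) (toL2 F K c₀ X'') = 0 := by
    have h0 : DeltaEtaSlot F n K c₀ U₀ - (DeltaEta F n K c₀ U₀ : BondL2K ℂ 3 (periodsT3 F K) c₀ W₂ →ₗ[ℂ] BondL2K ℂ 3 (periodsT3 F K) c₀ W₂) = 0 := by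
      rw [sub_eq_zero]; rfl
    rw [h0, LinearMap.zero_apply]
  rw [hs1] at h1
  rw [hs2, inner_zero_right] at h2
  rw [h1, h2]; ring

/-- ★★ **(γ) AT THE SLOT FROM (γ) AT THE SLOT OF RECORD AND THE τ-ROW OF `S`**: `γ‖v‖² ≤ re⟪v, Δ_a^{η}v⟫` and `−τ‖v‖² ≤ re⟪v, S U₀ v⟫` for all `v` ⟹ `(γ − τ)‖v‖² ≤ re⟪v, Δ_a^{Δx}v⟫`.
[cite: Balaban1985BackgroundPropagators, Thm 3.3 p.398, (3.128) p.421] -/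
theorem hco_slot_of_eta (U₀ : GaugeField (F.P K) 0 (Matrix.specialUnitaryGroup (Fin 2) ℂ))
    (hΔx : ∀ v : BondL2K ℂ 3 (periodsT3 F K) c₀ W₂, Δx U₀ v = DeltaEta F n K c₀ U₀ v + S U₀ v) {γ τ : ℝ}
    (hco : ∀ v : BondL2K ℂ 3 (periodsT3 F K) c₀ W₂, γ * ‖v‖ ^ 2 ≤ RCLike.re ⟪v, laplaceA F n K h c₀ cB a (DeltaEtaSlot F n K c₀) U₀ v⟫_ℂ)
    (hSτ : ∀ v : BondL2K ℂ 3 (periodsT3 F K) c₀ W₂, -(τ * ‖v‖ ^ 2) ≤ RCLike.re ⟪v, S U₀ v⟫_ℂ) :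
    ∀ v : BondL2K ℂ 3 (periodsT3 F K) c₀ W₂, (γ - τ) * ‖v‖ ^ 2 ≤ RCLike.re ⟪v, laplaceA F n K h c₀ cB a Δx U₀ v⟫_ℂ := by
  intro v
  obtain ⟨X, rfl⟩ : ∃ X, v = toL2 F K c₀ X := ⟨(toL2 F K c₀).symm v, ((toL2 F K c₀).apply_symm_apply v).symm⟩
  rw [inner_laplaceA_slot_eq_add F h c₀ cB (a := a) U₀ hΔx, map_add]
  have h1 := hco (toL2 F K c₀ X)
  have h2 := hSτ (toL2 F K c₀ X)
  linarith

/-- ★★ **(C_V) AT THE SLOT FROM (C_V) AT THE SLOT OF RECORD AND THE τ-ROW OF `S`** (A3's `hVlow` text): `C_V` at `Δ_a^{η}` ⟹ `C_V + τ` at `Δ_a^{Δx}`.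
[cite: Balaban1985Variational, (134)–(136) p.298; Balaban1985BackgroundPropagators, (3.128) p.421] -/
theorem hVlow_slot_of_eta (U₀ : GaugeField (F.P K) 0 (Matrix.specialUnitaryGroup (Fin 2) ℂ))
    (hΔx : ∀ v : BondL2K ℂ 3 (periodsT3 F K) c₀ W₂, Δx U₀ v = DeltaEta F n K c₀ U₀ v + S U₀ v) {CV τ : ℝ}
    (hVlow : ∀ X : PBond (F.P K) 0 → Matrix (Fin 2) (Fin 2) ℂ,
      -(CV * ‖toL2 F K c₀ X‖ ^ 2) ≤ RCLike.re ⟪toL2 F K c₀ X, laplaceA F n K h c₀ cB a (DeltaEtaSlot F n K c₀) U₀ (toL2 F K c₀ X)⟫_ℂ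
        - ∑ μ : Fin (F.P K).d, ‖DL2 F n K c₀ U₀ (toL2S F K c₀ (formComp X μ))‖ ^ 2)
    (hSτ : ∀ v : BondL2K ℂ 3 (periodsT3 F K) c₀ W₂, -(τ * ‖v‖ ^ 2) ≤ RCLike.re ⟪v, S U₀ v⟫_ℂ) :
    ∀ X : PBond (F.P K) 0 → Matrix (Fin 2) (Fin 2) ℂ,
      -((CV + τ) * ‖toL2 F K c₀ X‖ ^ 2) ≤ RCLike.re ⟪toL2 F K c₀ X, laplaceA F n K h c₀ cB a Δx U₀ (toL2 F K c₀ X)⟫_ℂ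
        - ∑ μ : Fin (F.P K).d, ‖DL2 F n K c₀ U₀ (toL2S F K c₀ (formComp X μ))‖ ^ 2 := by
  intro X
  rw [inner_laplaceA_slot_eq_add F h c₀ cB (a := a) U₀ hΔx, map_add]
  have h1 := hVlow X
  have h2 := hSτ (toL2 F K c₀ X)
  linarith

/-- **THE τ-ROW GIVES THE ONE-SIDED FORM ROW**: `‖⟪u, S v⟫‖ ≤ τ‖u‖‖v‖` for all `u, v` ⟹ `−τ‖v‖² ≤ re⟪v, S v⟫` (the input shape of the two theorems above from ✓`tauRow_TJP_of_supRow`'s output).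
[folklore] -/
theorem form_row_of_tau_row (U₀ : GaugeField (F.P K) 0 (Matrix.specialUnitaryGroup (Fin 2) ℂ)) {τ : ℝ}
    (hτ : ∀ u v : BondL2K ℂ 3 (periodsT3 F K) c₀ W₂, ‖⟪u, S U₀ v⟫_ℂ‖ ≤ τ * ‖u‖ * ‖v‖) :
    ∀ v : BondL2K ℂ 3 (periodsT3 F K) c₀ W₂, -(τ * ‖v‖ ^ 2) ≤ RCLike.re ⟪v, S U₀ v⟫_ℂ := by
  intro v
  have h1 := hτ v v
  have h2 := (abs_le.mp ((RCLike.abs_re_le_norm ⟪v, S U₀ v⟫_ℂ).trans h1)).1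
  nlinarith [h2]

end Summit.QuantumFields.YangMills.Theorems.Prop7OneFormSlotFormGlue

end
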